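import Mathlib.Analysis.InnerProductSpace.PiL2
import Literature.MathematicalPhysics.QuantumLattice.MinkowskiGeometry
import Literature.Geometry.Lorentzian.KerrSchild
import HarnessLib

-- provenance: harness21/H21/H21/Prelude/QLatticeAQFT/MinkowskiLorentzBridge.lean @ 7095ce4 (interim HEAD d8f2665); M5 mechanical rewrite
/-!
# Bridge between the AQFT Minkowski conventions and the Lorentz-geometry prelude

Trunk `QLatticeAQFT` (G13), item A15b `MinkowskiLorentzBridge` (outline decision A-D4, review
finding F8), notion `minkowski_poincare_group`.

Trunk G13 (`Literature.Prelude.QLatticeAQFT.MinkowskiGeometry`) sets up `(d+1)`-dimensional Minkowski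
space as `SpaceTime d = EuclideanSpace ℝ (Fin (d + 1))` with the Minkowski form
`minkowskiForm d` of signature `(+, −, …, −)` — the particle-physics / Streater–Wightman
convention (*PCT, Spin and Statistics, and All That* (1964), §1-1, eq. (1-1)). Trunk G08
(`Literature.Prelude.Lorentz.Basic`, `Literature.Prelude.Lorentz.KerrSchild`) sets up `Lorentz.E4 =
EuclideanSpace ℝ (Fin 4)` with the Minkowski form `Lorentz.Minkowski.bilin` of signature
`(−, +, +, +)` — the relativist's convention (O'Neill, *Semi-Riemannian Geometry* (1983), Ch. 3,
p. 55; Hawking–Ellis (1973), §2.5). This tiny file records that for `d = 3` the two set-ups agree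
up to the global sign:

* `spaceTime_three_eq_E4 : SpaceTime 3 = Lorentz.E4` (by `rfl`);
* `minkowskiForm_three_eq_neg_bilin : minkowskiForm 3 = -Lorentz.Minkowski.bilin` (real proof);
* `isTimelike_three_iff : IsTimelike v ↔ Lorentz.Minkowski.bilin v v < 0`, i.e. G13-timelike is
  G08-timelike for the flat metric `Lorentz.Minkowski.metric` (`isTimelike_three_iff_metric`);
* `timeC_eq_time : timeC v = Lorentz.E4.time v`, `spaceC_three_eq_spatial`.

## Why a separate file

`Literature.Prelude.Lorentz.KerrSchild` imports the whole manifold stack (`LorentzianMetric`,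
`LeviCivita`, `Einstein`). The Wightman / Osterwalder–Schrader files (A16, A17) must stay light
and import only `MinkowskiGeometry`; anything that needs both conventions imports this bridge.

## Mathlib

Mathlib (pinned) has no Minkowski form or Lorentz group (`rg -i minkowski` only hits Minkowski
sums / Minkowski's convex-body theorem). Nothing is defined here; only bridging lemmas.

## The closed forward cone in G08 terms

`closedForwardCone 3 = {p | ‖spaceC 3 p‖ ≤ p 0}` is, in G08 language, the set of
future-directed causal-or-zero vectors of `Lorentz.Minkowski.metric` with respect to the time
orientation `Lorentz.Minkowski.timeOrientation` (`∂₀` future-pointing):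
`{p | Lorentz.Minkowski.bilin p p ≤ 0 ∧ 0 ≤ Lorentz.E4.time p}`; see
`mem_closedForwardCone_three_iff`.
-/

noncomputable section

namespace Literature.MathematicalPhysics.QuantumLattice


/-- For `d = 3`, G13's space-time *is* G08's `E4`: both are `EuclideanSpace ℝ (Fin 4)`
(outline A-D4; Streater–Wightman (1964), §1-1 vs Dafermos–Rodnianski, arXiv:0811.0354, §5.1). [cite: StreaterWightman1964] -/
theorem spaceTime_three_eq_E4 : SpaceTime 3 = Literature.Geometry.Lorentzian.E4 := rfl

/-- G13's time coordinate is G08's: `timeC v = Lorentz.E4.time v = v 0`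
(Streater–Wightman (1964), §1-1; Dafermos–Rodnianski, arXiv:0811.0354, §5.1). [cite: StreaterWightman1964] -/
theorem timeC_eq_time (v : SpaceTime 3) : timeC v = Literature.Geometry.Lorentzian.E4.time (v : Literature.Geometry.Lorentzian.E4) := rfl

/-- G13's spatial projection is G08's: `spaceC 3 = Lorentz.E4.spatial` as continuous linear maps
`ℝ⁴ → ℝ³` (Streater–Wightman (1964), §1-1; Dafermos–Rodnianski, arXiv:0811.0354, §5.1). [cite: StreaterWightman1964] -/
theorem spaceC_three_eq_spatial : spaceC 3 = Literature.Geometry.Lorentzian.E4.spatial := rfl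

/-- **Sign bridge, pointwise.** `η_{SW}(v, w) = −η_{O'N}(v, w)`: the Streater–Wightman form
`(+, −, −, −)` (Streater–Wightman (1964), eq. (1-1)) is minus the O'Neill form `(−, +, +, +)`
(O'Neill (1983), Ch. 3, p. 55) used in trunk G08. [cite: StreaterWightman1964] -/
theorem minkowskiForm_three_apply_eq (v w : SpaceTime 3) :
    minkowskiForm 3 v w = -Literature.Geometry.Lorentzian.Minkowski.bilin (v : Literature.Geometry.Lorentzian.E4) w := by
  rw [minkowskiForm_apply, Literature.Geometry.Lorentzian.Minkowski.bilin_apply (v : Literature.Geometry.Lorentzian.E4) w]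
  ring

/-- **Sign bridge.** `minkowskiForm 3 = -Lorentz.Minkowski.bilin` as continuous bilinear forms on
`ℝ⁴`: signature `(+, −, −, −)` (Streater–Wightman (1964), eq. (1-1)) versus `(−, +, +, +)`
(O'Neill (1983), Ch. 3, p. 55; Hawking–Ellis (1973), §2.5). Outline A-D4 / review F8. [cite: StreaterWightman1964] -/
theorem minkowskiForm_three_eq_neg_bilin : minkowskiForm 3 = -Literature.Geometry.Lorentzian.Minkowski.bilin := by
  ext v w
  simp only [_root_.neg_apply, minkowskiForm_three_apply_eq]

/-- `η_{SW}(v, v) = −η_{O'N}(v, v)` (diagonal case of `minkowskiForm_three_apply_eq`). [folklore] -/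
theorem minkowskiForm_three_self_eq (v : SpaceTime 3) :
    minkowskiForm 3 v v = -Literature.Geometry.Lorentzian.Minkowski.bilin (v : Literature.Geometry.Lorentzian.E4) v :=
  minkowskiForm_three_apply_eq v v

/-- G13-timelike (`η_{SW}(v, v) > 0`, Streater–Wightman (1964), §1-1) iff G08-timelike
(`η_{O'N}(v, v) < 0`, O'Neill (1983), Ch. 3, p. 56). [cite: StreaterWightman1964] -/
theorem isTimelike_three_iff (v : SpaceTime 3) :
    IsTimelike v ↔ Literature.Geometry.Lorentzian.Minkowski.bilin (v : Literature.Geometry.Lorentzian.E4) v < 0 := by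
  rw [IsTimelike, minkowskiForm_three_self_eq, neg_pos]

/-- G13-spacelike (`η_{SW}(v, v) < 0`, Streater–Wightman (1964), §1-1) iff `η_{O'N}(v, v) > 0`
(O'Neill (1983), Ch. 3, p. 56; note G08's `LorentzianMetric.IsSpacelike` additionally admits
`v = 0`). [cite: StreaterWightman1964] -/
theorem isSpacelike_three_iff (v : SpaceTime 3) :
    IsSpacelike v ↔ 0 < Literature.Geometry.Lorentzian.Minkowski.bilin (v : Literature.Geometry.Lorentzian.E4) v := by
  rw [IsSpacelike, minkowskiForm_three_self_eq, neg_lt_zero]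

/-- G13-lightlike (`η_{SW}(v, v) = 0`, Streater–Wightman (1964), §1-1) iff `η_{O'N}(v, v) = 0`
(O'Neill (1983), Ch. 3, p. 56; G08's `LorentzianMetric.IsNull` additionally requires `v ≠ 0`). [cite: StreaterWightman1964] -/
theorem isLightlike_three_iff (v : SpaceTime 3) :
    IsLightlike v ↔ Literature.Geometry.Lorentzian.Minkowski.bilin (v : Literature.Geometry.Lorentzian.E4) v = 0 := by
  rw [IsLightlike, minkowskiForm_three_self_eq, neg_eq_zero]

/-- G13-timelike iff timelike for G08's flat Lorentzian metric `Lorentz.Minkowski.metric` on `E4`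
(as a tangent vector at any base point `x`; O'Neill (1983), Ch. 3, p. 56). [cite: ONeill1983] -/
theorem isTimelike_three_iff_metric (x : Literature.Geometry.Lorentzian.E4) (v : SpaceTime 3) :
    IsTimelike v ↔ Literature.Geometry.Lorentzian.Minkowski.metric.IsTimelike (x := x) (v : Literature.Geometry.Lorentzian.E4) := by
  rw [Literature.Geometry.Lorentzian.LorentzianMetric.isTimelike_iff, Literature.Geometry.Lorentzian.Minkowski.metric_val]
  exact isTimelike_three_iff v

/-- The closed forward light cone `V̄₊ = {p | ‖p⃗‖ ≤ p⁰}` (Streater–Wightman (1964), §3-1) in G08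
terms: `η_{O'N}(p, p) ≤ 0` and `t*(p) ≥ 0`, i.e. `p` is zero or future-directed causal for
`Lorentz.Minkowski.metric` / `Lorentz.Minkowski.timeOrientation` (O'Neill (1983), Ch. 5,
p. 140). [cite: StreaterWightman1964] -/
theorem mem_closedForwardCone_three_iff (p : SpaceTime 3) :
    p ∈ closedForwardCone 3 ↔
      Literature.Geometry.Lorentzian.Minkowski.bilin (p : Literature.Geometry.Lorentzian.E4) p ≤ 0 ∧ 0 ≤ Literature.Geometry.Lorentzian.E4.time (p : Literature.Geometry.Lorentzian.E4) := by
  rw [mem_closedForwardCone_iff, ← neg_nonneg, ← minkowskiForm_three_self_eq, minkowskiForm_self,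
    sub_nonneg, Literature.Geometry.Lorentzian.E4.time_apply]
  constructor
  · intro h
    have h0 : 0 ≤ p 0 := (norm_nonneg _).trans h
    exact ⟨pow_le_pow_left₀ (norm_nonneg _) h 2, h0⟩
  · rintro ⟨h, h0⟩
    exact (pow_le_pow_iff_left₀ (norm_nonneg _) h0 two_ne_zero).1 h

end Literature.MathematicalPhysics.QuantumLattice
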